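/-
Copyright (c) 2026 the pub-hodgecm-mathlib formalisation cell (harness21).  Prover seat hodgecm-mathlib-A-p19 (g24) — (U) road, brick U3a «local frame-map factorisation», 2026-09-01.
-/
import Literature.NumberTheory.Rogawski1990.ArchUniversalPinRatioOfWallCompatible      -- ★ p844390 U5 (the (BRIDGE) tokens: torus-fixing `congr`, hρZ's `relabel`, ★ (V9) `endoEmb` wall-block map)
import Literature.NumberTheory.Weil1964.UnitaryArchSingularCentralizerFramePlaces        -- ★ p844365 (F0P3-p03 g11): the LOCAL FRAME MAP `u ↦ T_w (u₁ ⊕ᶠ u₂) T_w⁻¹` into `Z(γ_w)`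
import HarnessLib

/-!
# The local frame map of a wall frame FACTORS as «relabel ∘ torus-fixing congruence ∘ endoscopic block embedding» ((U) road, brick U3a; Rogawski 1990 §3.8, §8.2 p. 122)

Topic `NumberTheory/Weil1964`; namespace `Literature.NumberTheory.Weil1964.UnitaryArchTopForm` (home of ★ p844365).  THEOREMS ONLY (no `def`, no instance, no notation, no axiom, no
named fact, no `sorry`).  Cell `pub/hodgecm-mathlib`, crux H413 = `stmt-HodgeConjecture-24833` (supports only); the (U) road (owner A-p19 (g24), card `ROAD-U-v1`; LEAD F0P3a-plan
(g10) T9-36).  Count-neutral bookkeeping.  HONEST LABEL: HC_CM is proved only modulo the 2 remaining named inputs (hLiu418 24832, h413 24833) until rung 0 closes.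

WHY.  ★ p844365 `centralizerMeasureOfFrame_pi_eq_map_pi` writes the centraliser frame measure at `γ = t(z∘ρ)` as the telescope of the per-place push-forwards
`θ^frame_w := (μa ⊗ μb)_* (u ↦ T_w · (u₁ ⊕ᶠ u₂) · T_w⁻¹)`; ★ p844390 (U5) reads the per-place measures as `relabel(ρ_w)_* ∘ (e_D|_Z)_* ∘ ((μa ⊗ μb)_* ι_w)` with `ι_w` the ★ (V9)
endoscopic block embedding (pattern `{0,2} ∕ {1}`), `e_D` a TORUS-FIXING (diagonal) congruence and `relabel` the hρZ map (conjugation by `monomial ρ_w⁻¹ 1`).  For the ★ (b5)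
frames `T_w = monomial (ρ_w⁻¹ · (1 2)) c_w` the two agree: `monomial (σ⁻¹ · (1 2)) c = monomial σ⁻¹ 1 · diag(c ∘ (1 2)) · monomial (1 2) 1` and conjugation by `monomial (1 2) 1`
turns the `{0,1} ∕ {2}` block pattern (`blockDiagFin`, `finSumFinEquiv`) into the `{0,2} ∕ {1}` pattern (`endoGL`, ★ `endoPerm = finSumFinEquiv.trans (1 2)`).
* §1 matrix algebra: `monomial_one_mul_mul_monomial_one_inv` (`M(τ,1) · A · M(τ⁻¹,1) = reindex τ τ A`), `monomial_one_mul_monomial_one_inv`, `reindex_swap_reindex_finSumFinEquiv_eq_reindex_endoPerm`,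
  `monomial_inv_mul_swap_eq` (the factorisation of `monomial (σ⁻¹ · (1 2)) c`).
* §2 `GL`-level: `monomialGL_swap_mul_blockDiagFin_mul_inv` (`P · ↑(u₁ ⊕ᶠ u₂) · P⁻¹ = ↑(ι(u₁,u₂))`), **`localFrame_val_eq`** (the frame conjugate `T_w · ↑(u₁ ⊕ᶠ u₂) · T_w⁻¹ =
  M(σ⁻¹) · (D · ↑ι(u) · D⁻¹) · M(σ⁻¹)⁻¹` when `↑T_w = monomial (σ⁻¹ · (1 2)) c`, `↑D = diag(c ∘ (1 2))`).
* §3 **`map_localFrame_eq_map_relabel_congr_wallBlock`** — THE MEASURE FORM: ★ p844365's `θ^frame_w` at `(J, J₁, J₂) = (diag α, diag(β₀,β₂), (β₁))`, `γ_w = diag(zw ∘ σ)`, EQUALS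
  `((((μa ⊗ μb)_* ι_w).map (e_D|_Z)).map relabel(σ))` — the `Λ_w` of ★ U5's (BRIDGE) and the `θ_w` of F0P3-p03's assembler, token for token.

## References
* [Rogawski1990] J. D. Rogawski, *Automorphic Representations of Unitary Groups in Three Variables*, Ann. of Math. Stud. 123 (1990), §3.8 Prop. 3.8.1 (a) p. 30; §4.8 Case (a) p. 53; §8.2 p. 122.
* [BrockerTomDieck1985] T. Bröcker, T. tom Dieck, *Representations of Compact Lie Groups* (1985), IV (3.2) (monomial matrices, Weyl group of `U(n)`).
* [PlatonovRapinchuk1994] V. Platonov, A. Rapinchuk, *Algebraic Groups and Number Theory* (1994), §2.3.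
-/

set_option autoImplicit false

noncomputable section

open MeasureTheory Measure Set Filter Topology NumberField NumberField.InfinitePlace NumberField.mixedEmbedding Matrix Equiv
open Literature.MeasureTheory.Group Literature.NumberTheory.Automorphic Literature.NumberTheory.Automorphic.UnitaryGroup
open Literature.LinearAlgebra.Matrix Literature.NumberTheory.Rogawski1990
open scoped ENNReal NNReal Classical Matrix MatrixGroups Matrix.Norms.Operator ContDiff ComplexConjugate

namespace Literature.NumberTheory.Weil1964

namespace UnitaryArchTopForm

/-! ## §1 Matrix algebra: conjugation by permutation matrices, and the factorisation of `monomial (σ⁻¹ · (1 2)) c` -/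

section MatrixAlgebra

variable {n : Type*} [Fintype n] [DecidableEq n] {R : Type*} [CommRing R]

/-- `M(τ, 1) · A · M(τ⁻¹, 1) = reindex τ τ A`: conjugation by a permutation matrix re-indexes. [cite: BrockerTomDieck1985, IV (3.2)] -/
theorem monomial_one_mul_mul_monomial_one_inv (τ : Perm n) (A : Matrix n n R) :
    monomial τ (fun _ => (1 : R)) * A * monomial τ⁻¹ (fun _ => (1 : R)) = Matrix.reindex τ τ A := by
  ext i k
  rw [Matrix.reindex_apply, Matrix.submatrix_apply, Matrix.mul_apply, Finset.sum_eq_single (τ.symm k)]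
  · rw [monomial_apply τ⁻¹, if_pos (show τ.symm k = τ⁻¹ k from rfl), mul_one, Matrix.mul_apply, Finset.sum_eq_single (τ.symm i)]
    · rw [monomial_apply, if_pos (τ.apply_symm_apply i).symm, one_mul]
    · intro j _ hj
      rw [monomial_apply, if_neg (fun h => hj (by rw [h, Equiv.symm_apply_apply])), zero_mul]
    · intro h; exact absurd (Finset.mem_univ _) h
  · intro j _ hj
    rw [monomial_apply τ⁻¹, if_neg (show ¬ j = τ⁻¹ k from hj), mul_zero]
  · intro h; exact absurd (Finset.mem_univ _) h

/-- `M(τ, 1) · M(τ⁻¹, 1) = 1`. [cite: BrockerTomDieck1985, IV (3.2)] -/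
theorem monomial_one_mul_monomial_one_inv (τ : Perm n) :
    monomial τ (fun _ => (1 : R)) * monomial τ⁻¹ (fun _ => (1 : R)) = 1 := by
  rw [monomial_mul_monomial, mul_inv_cancel]
  simp only [mul_one]
  exact monomial_one_one

/-- The inverse of the permutation matrix `M(τ, 1)` is `M(τ⁻¹, 1)`. [cite: BrockerTomDieck1985, IV (3.2)] -/
theorem monomial_one_inv (τ : Perm n) : (monomial τ (fun _ => (1 : R)))⁻¹ = monomial τ⁻¹ (fun _ => (1 : R)) :=
  Matrix.inv_eq_right_inv (monomial_one_mul_monomial_one_inv τ)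

/-- **The factorisation of the (b5) frame matrix**: `monomial (σ⁻¹ · (1 2)) c = M(σ⁻¹, 1) · diag(c ∘ (1 2)) · M((1 2), 1)`. [cite: BrockerTomDieck1985, IV (3.2)] -/
theorem monomial_inv_mul_swap_eq (σ : Perm (Fin 3)) (c : Fin 3 → R) :
    monomial (σ⁻¹ * Equiv.swap (1 : Fin 3) 2) c =
      monomial σ⁻¹ (fun _ => (1 : R)) * Matrix.diagonal (fun j => c (Equiv.swap (1 : Fin 3) 2 j)) * monomial (Equiv.swap (1 : Fin 3) 2) (fun _ => (1 : R)) := by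
  rw [monomial_mul_diagonal, monomial_mul_monomial]
  congr 1
  funext j
  rw [one_mul, mul_one, Equiv.swap_apply_self]

omit [Fintype n] [DecidableEq n] [CommRing R] in
/-- `reindex (1 2) (1 2) ∘ reindex finSumFinEquiv finSumFinEquiv = reindex endoPerm endoPerm` (★ `endoPerm = finSumFinEquiv.trans (1 2)`). [cite: Rogawski1990, §4.8 Case (a) p. 53] -/
theorem reindex_swap_reindex_finSumFinEquiv_eq_reindex_endoPerm (A : Matrix (Fin 2 ⊕ Fin 1) (Fin 2 ⊕ Fin 1) R) :
    Matrix.reindex (Equiv.swap (1 : Fin 3) 2) (Equiv.swap (1 : Fin 3) 2) (Matrix.reindex finSumFinEquiv finSumFinEquiv A) = Matrix.reindex endoPerm endoPerm A := by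
  rw [Matrix.reindex_apply, Matrix.reindex_apply, Matrix.reindex_apply, Matrix.submatrix_submatrix]
  rfl

end MatrixAlgebra

/-! ## §2 `GL`-level: conjugating the `{0,1}∕{2}` block embedding by `M((1 2), 1)` gives the endoscopic `{0,2}∕{1}` embedding; the frame conjugate factors -/

section GLLevel

variable {J₂ : Matrix (Fin 2) (Fin 2) ℂ} {J₁ : Matrix (Fin 1) (Fin 1) ℂ} {J₃ : Matrix (Fin 3) (Fin 3) ℂ}

/-- **`P · ↑(u₁ ⊕ᶠ u₂) · P⁻¹ = ↑ι(u₁, u₂)`** for `P = M((1 2), 1)`: the swap of the last two coordinates carries ★ `blockDiagFin` (`finSumFinEquiv`: blocks on `{0,1} ∕ {2}`) to ★ `endoEmb`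
(`endoPerm`: blocks on `{0,2} ∕ {1}`). [cite: Rogawski1990, §4.8 Case (a) p. 53] -/
theorem monomialGL_swap_mul_blockDiagFin_mul_inv (h : endoForm J₂ J₁ = J₃) (u : unitaryGroupOfForm (starRingEnd ℂ) J₂ × unitaryGroupOfForm (starRingEnd ℂ) J₁) :
    Matrix.GeneralLinearGroup.mkOfDetNeZero _ (det_monomial_one_ne_zero 3 (Equiv.swap (1 : Fin 3) 2)) *
        ((blockDiagFin (starRingEnd ℂ) J₂ J₁ u : unitaryGroupOfForm (starRingEnd ℂ) (finSum 2 1 J₂ J₁)) : GL (Fin 3) ℂ) *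
        (Matrix.GeneralLinearGroup.mkOfDetNeZero _ (det_monomial_one_ne_zero 3 (Equiv.swap (1 : Fin 3) 2)))⁻¹ =
      ((endoEmb (starRingEnd ℂ) J₂ J₁ J₃ h u : unitaryGroupOfForm (starRingEnd ℂ) J₃) : GL (Fin 3) ℂ) := by
  apply Units.ext
  rw [Units.val_mul, Units.val_mul, Matrix.coe_units_inv, coe_blockDiagFin, coe_endoEmb, coe_endoGL]
  change monomial (Equiv.swap (1 : Fin 3) 2) (fun _ => (1 : ℂ)) * _ * (monomial (Equiv.swap (1 : Fin 3) 2) (fun _ => (1 : ℂ)))⁻¹ = _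
  rw [monomial_one_inv, ← reindex_swap_reindex_finSumFinEquiv_eq_reindex_endoPerm, ← monomial_one_mul_mul_monomial_one_inv]

/-- **THE FRAME CONJUGATE FACTORS**: if `↑T_w = monomial (σ⁻¹ · (1 2)) c` and `↑D = diag(c ∘ (1 2))`, then for every block pair `u`,
`T_w · ↑(u₁ ⊕ᶠ u₂) · T_w⁻¹ = M(σ⁻¹) · (D · ↑ι(u) · D⁻¹) · M(σ⁻¹)⁻¹` with `M(σ⁻¹) = mkOfDetNeZero (monomial σ⁻¹ 1) _` (hρZ's relabelling matrix).
[cite: Rogawski1990, §3.8 Prop. 3.8.1 (a) p. 30; §8.2 p. 122] [cite: BrockerTomDieck1985, IV (3.2)] -/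
theorem localFrame_val_eq (h : endoForm J₂ J₁ = J₃) (σ : Perm (Fin 3)) (c : Fin 3 → ℂ) (Tw D : GL (Fin 3) ℂ)
    (hTw : (Tw : Matrix (Fin 3) (Fin 3) ℂ) = monomial (σ⁻¹ * Equiv.swap (1 : Fin 3) 2) c)
    (hD : (D : Matrix (Fin 3) (Fin 3) ℂ) = Matrix.diagonal (fun j => c (Equiv.swap (1 : Fin 3) 2 j)))
    (u : unitaryGroupOfForm (starRingEnd ℂ) J₂ × unitaryGroupOfForm (starRingEnd ℂ) J₁) :
    Tw * ((blockDiagFin (starRingEnd ℂ) J₂ J₁ u : unitaryGroupOfForm (starRingEnd ℂ) (finSum 2 1 J₂ J₁)) : GL (Fin 3) ℂ) * Tw⁻¹ =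
      Matrix.GeneralLinearGroup.mkOfDetNeZero _ (det_monomial_one_ne_zero 3 σ⁻¹) *
        (D * ((endoEmb (starRingEnd ℂ) J₂ J₁ J₃ h u : unitaryGroupOfForm (starRingEnd ℂ) J₃) : GL (Fin 3) ℂ) * D⁻¹) *
        (Matrix.GeneralLinearGroup.mkOfDetNeZero _ (det_monomial_one_ne_zero 3 σ⁻¹))⁻¹ := by
  -- `T_w = M(σ⁻¹) · D · P` in `GL₃(ℂ)`
  have hT : Tw = Matrix.GeneralLinearGroup.mkOfDetNeZero _ (det_monomial_one_ne_zero 3 σ⁻¹) * D *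
      Matrix.GeneralLinearGroup.mkOfDetNeZero _ (det_monomial_one_ne_zero 3 (Equiv.swap (1 : Fin 3) 2)) := by
    apply Units.ext
    rw [Units.val_mul, Units.val_mul, hTw, hD, monomial_inv_mul_swap_eq]
    rfl
  rw [← monomialGL_swap_mul_blockDiagFin_mul_inv h u, hT]
  simp only [_root_.mul_inv_rev, mul_assoc]

end GLLevel

/-! ## §3 The measure form: ★ p844365's local frame measure = ★ U5's `relabel ∘ congr ∘ wall-block` measure -/

section MeasureForm

variable (L : Type) [Field L] [NumberField L] [IsCMField L] (α β : Fin 3 → L) (w : {w : InfinitePlace L // IsComplex w})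
  [MeasurableSpace (GL (Fin 3) ℂ)] [BorelSpace (GL (Fin 3) ℂ)] [MeasurableSpace (GL (Fin 2) ℂ)] [BorelSpace (GL (Fin 2) ℂ)]
  [MeasurableSpace (GL (Fin 1) ℂ)] [BorelSpace (GL (Fin 1) ℂ)]

omit [NumberField L] [IsCMField L] in
/-- **THE LOCAL FRAME MEASURE FACTORS THROUGH THE WALL-BLOCK MEASURE.**  At a place `w`, carriers `α` (ambient) and `β` (the blocks `diag(β₀,β₂)`, `(β₁)`), a relabelling `σ`,
a wall datum `zw` (`zw 0 = zw 2 ≠ zw 1`), a reference wall `z₁`, and a local frame `T_w` of `γ_w = diag(zw ∘ σ)` with `↑T_w = monomial (σ⁻¹ · (1 2)) c` (the ★ (b5) frames) and its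
diagonal part `D = diag(c ∘ (1 2))`, a torus-fixing congruence `G_w(β) ≃ G_w(α ∘ σ⁻¹)` (`hcongrD`, `htorusD`): the push-forward of `μa ⊗ μb` along ★ p844365's local frame map
`u ↦ T_w (u₁ ⊕ᶠ u₂) T_w⁻¹` (valued in `Z_w(γ_w)`) EQUALS `(((μa ⊗ μb)_* ι_w).map (e_D|_Z)).map relabel(σ)` — ★ U5 p844390's `Λ_w` (BRIDGE) token for token.
[cite: Rogawski1990, §3.8 Prop. 3.8.1 (a) p. 30; §8.2 p. 122] [cite: PlatonovRapinchuk1994, §2.3] -/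
theorem map_localFrame_eq_map_relabel_congr_wallBlock (σ : Perm (Fin 3)) (c : Fin 3 → ℂ) {Tw : GL (Fin 3) ℂ} (D : GL (Fin 3) ℂ)
    (hTw' : (Tw : Matrix (Fin 3) (Fin 3) ℂ) = monomial (σ⁻¹ * Equiv.swap (1 : Fin 3) 2) c)
    (hD : (D : Matrix (Fin 3) (Fin 3) ℂ) = Matrix.diagonal (fun j => c (Equiv.swap (1 : Fin 3) 2 j)))
    (hTw : formCongr (starRingEnd ℂ) Tw ((Matrix.diagonal α).map w.1.embedding) =
      (finSum 2 1 (Matrix.diagonal ![β 0, β 2]) (Matrix.diagonal ![β 1])).map w.1.embedding)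
    (hcongrD : formCongr (starRingEnd ℂ) D ((Matrix.diagonal (α ∘ ⇑σ⁻¹)).map w.1.embedding) = (Matrix.diagonal β).map w.1.embedding)
    (htorusD : ∀ zz : Fin 3 → Circle, D * circleDiagonal 3 zz * D⁻¹ = circleDiagonal 3 zz)
    {zw z₁ : Fin 3 → Circle} (hw02 : zw 0 = zw 2) (hw01 : zw 0 ≠ zw 1) (h02 : z₁ 0 = z₁ 2) (h01 : z₁ 0 ≠ z₁ 1)
    {a b : ℂ} (hγ : (((⟨circleDiagonal 3 (zw ∘ ⇑σ), circleDiagonal_mem_archLocal_diagonal L 3 α w (zw ∘ ⇑σ)⟩ : archLocal L 3 (Matrix.diagonal α) w) : GL (Fin 3) ℂ) : Matrix (Fin 3) (Fin 3) ℂ) * (Tw : Matrix (Fin 3) (Fin 3) ℂ) =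
      (Tw : Matrix (Fin 3) (Fin 3) ℂ) * finSum 2 1 (a • (1 : Matrix (Fin 2) (Fin 2) ℂ)) (b • 1))
    (μa : Measure (archLocal L 2 (Matrix.diagonal ![β 0, β 2]) w)) (μb : Measure (archLocal L 1 (Matrix.diagonal ![β 1]) w)) :
    Measure.map (fun u : ↥(archLocal L 2 (Matrix.diagonal ![β 0, β 2]) w) × ↥(archLocal L 1 (Matrix.diagonal ![β 1]) w) =>
      (⟨⟨Tw * ((blockDiagFin (starRingEnd ℂ) ((Matrix.diagonal ![β 0, β 2]).map w.1.embedding) ((Matrix.diagonal ![β 1]).map w.1.embedding) u :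
            unitaryGroupOfForm (starRingEnd ℂ) (finSum 2 1 ((Matrix.diagonal ![β 0, β 2]).map w.1.embedding) ((Matrix.diagonal ![β 1]).map w.1.embedding))) : GL (Fin 3) ℂ) * Tw⁻¹,
          conj_blockDiagFin_mem_archLocal L w hTw u⟩,
        conj_blockDiagFin_mem_centralizer L w hTw (⟨circleDiagonal 3 (zw ∘ ⇑σ), circleDiagonal_mem_archLocal_diagonal L 3 α w (zw ∘ ⇑σ)⟩ : archLocal L 3 (Matrix.diagonal α) w) hγ u⟩ : ↥(Subgroup.centralizer ({(⟨circleDiagonal 3 (zw ∘ ⇑σ), circleDiagonal_mem_archLocal_diagonal L 3 α w (zw ∘ ⇑σ)⟩ : archLocal L 3 (Matrix.diagonal α) w)} : Set (archLocal L 3 (Matrix.diagonal α) w))))) (μa.prod μb) =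
      (((Measure.map (fun p : ↥(archLocal L 2 (Matrix.diagonal ![β 0, β 2]) w) × ↥(archLocal L 1 (Matrix.diagonal ![β 1]) w) =>
            (⟨endoEmb (starRingEnd ℂ) ((Matrix.diagonal ![β 0, β 2]).map w.1.embedding) ((Matrix.diagonal ![β 1]).map w.1.embedding)
                ((Matrix.diagonal β).map w.1.embedding) (endoForm_archLocal_diagonal L β w) p,
              endoEmb_mem_centralizer_circleDiagonal L β w h02 p⟩ : ↥(Subgroup.centralizer ({(⟨circleDiagonal 3 z₁, circleDiagonal_mem_archLocal_diagonal L 3 β w z₁⟩ : archLocal L 3 (Matrix.diagonal β) w)} : Set (archLocal L 3 (Matrix.diagonal β) w)))))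
          ((μa).prod (μb)))).map
        (subgroupCongrHomeomorph (ContinuousMulEquiv.restrictSubgroup (GLn.conjEquiv D) (archLocal L 3 (Matrix.diagonal β) w) (archLocal L 3 (Matrix.diagonal (α ∘ ⇑σ⁻¹)) w) (mem_archLocal_diagonal_iff_conjEquiv_mem_of_formCongr_eq L 3 β (α ∘ ⇑σ⁻¹) w D hcongrD)).toMulEquiv
        (Subgroup.centralizer ({(⟨circleDiagonal 3 z₁, circleDiagonal_mem_archLocal_diagonal L 3 β w z₁⟩ : archLocal L 3 (Matrix.diagonal β) w)} : Set (archLocal L 3 (Matrix.diagonal β) w)))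
        (Subgroup.centralizer ({(⟨circleDiagonal 3 z₁, circleDiagonal_mem_archLocal_diagonal L 3 (α ∘ ⇑σ⁻¹) w z₁⟩ : archLocal L 3 (Matrix.diagonal (α ∘ ⇑σ⁻¹)) w)} : Set (archLocal L 3 (Matrix.diagonal (α ∘ ⇑σ⁻¹)) w)))
        (forall_apply_mem_centralizer_singleton_iff_of_eq (ContinuousMulEquiv.restrictSubgroup (GLn.conjEquiv D) (archLocal L 3 (Matrix.diagonal β) w) (archLocal L 3 (Matrix.diagonal (α ∘ ⇑σ⁻¹)) w) (mem_archLocal_diagonal_iff_conjEquiv_mem_of_formCongr_eq L 3 β (α ∘ ⇑σ⁻¹) w D hcongrD)).toMulEquiv (congrT_circleDiagonal L 3 β (α ∘ ⇑σ⁻¹) w D hcongrD htorusD z₁))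
        (ContinuousMulEquiv.restrictSubgroup (GLn.conjEquiv D) (archLocal L 3 (Matrix.diagonal β) w) (archLocal L 3 (Matrix.diagonal (α ∘ ⇑σ⁻¹)) w) (mem_archLocal_diagonal_iff_conjEquiv_mem_of_formCongr_eq L 3 β (α ∘ ⇑σ⁻¹) w D hcongrD)).continuous
        (ContinuousMulEquiv.restrictSubgroup (GLn.conjEquiv D) (archLocal L 3 (Matrix.diagonal β) w) (archLocal L 3 (Matrix.diagonal (α ∘ ⇑σ⁻¹)) w) (mem_archLocal_diagonal_iff_conjEquiv_mem_of_formCongr_eq L 3 β (α ∘ ⇑σ⁻¹) w D hcongrD)).symm.continuous)).map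
        (subgroupCongrHomeomorph (ContinuousMulEquiv.restrictSubgroup (GLn.conjEquiv (Matrix.GeneralLinearGroup.mkOfDetNeZero _ (det_monomial_one_ne_zero 3 σ⁻¹))) (archLocal L 3 (Matrix.diagonal (α ∘ ⇑σ⁻¹)) w) (archLocal L 3 (Matrix.diagonal α) w) (mem_archLocal_comp_perm_iff_conj_mem L 3 α w σ⁻¹)).toMulEquiv
        (Subgroup.centralizer ({(⟨circleDiagonal 3 z₁, circleDiagonal_mem_archLocal_diagonal L 3 (α ∘ ⇑σ⁻¹) w z₁⟩ : archLocal L 3 (Matrix.diagonal (α ∘ ⇑σ⁻¹)) w)} : Set (archLocal L 3 (Matrix.diagonal (α ∘ ⇑σ⁻¹)) w)))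
        (Subgroup.centralizer ({(⟨circleDiagonal 3 (zw ∘ ⇑σ), circleDiagonal_mem_archLocal_diagonal L 3 α w (zw ∘ ⇑σ)⟩ : archLocal L 3 (Matrix.diagonal α) w)} : Set (archLocal L 3 (Matrix.diagonal α) w)))
        (relabel_inv_mem_centralizer_circleDiagonal_comp_iff L α w σ h02 h01 hw02 hw01)
        (ContinuousMulEquiv.restrictSubgroup (GLn.conjEquiv (Matrix.GeneralLinearGroup.mkOfDetNeZero _ (det_monomial_one_ne_zero 3 σ⁻¹))) (archLocal L 3 (Matrix.diagonal (α ∘ ⇑σ⁻¹)) w) (archLocal L 3 (Matrix.diagonal α) w) (mem_archLocal_comp_perm_iff_conj_mem L 3 α w σ⁻¹)).continuous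
        (ContinuousMulEquiv.restrictSubgroup (GLn.conjEquiv (Matrix.GeneralLinearGroup.mkOfDetNeZero _ (det_monomial_one_ne_zero 3 σ⁻¹))) (archLocal L 3 (Matrix.diagonal (α ∘ ⇑σ⁻¹)) w) (archLocal L 3 (Matrix.diagonal α) w) (mem_archLocal_comp_perm_iff_conj_mem L 3 α w σ⁻¹)).symm.continuous) := by
  -- both sides are push-forwards of `μa ⊗ μb`; compare the maps pointwise (second countability of the blocks, in both spellings of ★ `archLocal`)
  haveI := secondCountableTopology_archLocal L 2 (Matrix.diagonal ![β 0, β 2]) w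
  haveI := secondCountableTopology_archLocal L 1 (Matrix.diagonal ![β 1]) w
  haveI : SecondCountableTopology (unitaryGroupOfForm (starRingEnd ℂ) ((Matrix.diagonal ![β 0, β 2]).map w.1.embedding)) :=
    secondCountableTopology_archLocal L 2 (Matrix.diagonal ![β 0, β 2]) w
  haveI : SecondCountableTopology (unitaryGroupOfForm (starRingEnd ℂ) ((Matrix.diagonal ![β 1]).map w.1.embedding)) :=
    secondCountableTopology_archLocal L 1 (Matrix.diagonal ![β 1]) w
  rw [Measure.map_map (Homeomorph.continuous _).measurable (Homeomorph.continuous _).measurable,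
    Measure.map_map ((Homeomorph.continuous _).measurable.comp (Homeomorph.continuous _).measurable) ?_]
  swap
  · exact ((continuous_endoEmb (starRingEnd ℂ) (endoForm_archLocal_diagonal L β w)).subtype_mk _).measurable
  congr 1
  funext u
  apply Subtype.ext
  apply Subtype.ext
  show Tw * _ * Tw⁻¹ = _
  rw [localFrame_val_eq (endoForm_archLocal_diagonal L β w) σ c Tw D hTw' hD u]
  rfl

end MeasureForm

end UnitaryArchTopForm

end Literature.NumberTheory.Weil1964

end
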